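import Summits.RiemannHypothesis.RiemannHypothesis.Theorems.TiltedLandingLaw421MonovariantTentInit

/-! # TiltedLandingLaw421TwoSidedHeredity
c13/c14 RESTRICTED TENT HEREDITY §X (C1 rh-idea-5 g20, over C4 §T/§U tokens): `companions`, `tentSet`, `RealTent`, `NoEntry`, the research Props `TentHereditySig ρ` / `TentHereditySigObs ρ` / `TentHereditySigSlow ρ θ` / `TentHereditySigSlowEx ρ` (E⁺-core shapes with NAMED exception guards; none claimed), `tentHereditySigObs_of_sig`, `tentHereditySigSlow_mono`, `not_heredity_conclusion_of_empty`.
SUPPORT module for crux `TiltedLandingLaw421` (stmt-RiemannHypothesis-24774), `--supports` only: proves no stub, no crux; fully proved (no `sorry`).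
Packaged by C4 rh-idea-6 g21 per director (CA239)(1) in the (CA237) lint shape. RH is not proved. -/

namespace RhW07.C13.Heredity

open Complex
open RhIdea6.G17.W07C7 RhIdea6.G17.W07C7.Rev6 RhIdea6.G18.W07C8.Law421BirthS RhIdea6.G19.W07C11.Seam
open RhIdea6.G20.W07C12.Frac RhIdea6.G20.W07C12.StColP RhW07.C12.FieldSplit RhIdea6.G20.W07C13pre.Tent RhIdea6.G21.W07C13.TentMax

/-- the COMPANION SET of `u` for `g` in the strip `|Re z − c| ≤ r` (pair `{u, ū}` excluded) — the set §T's `tentCount` sums over. -/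
def companions (g : ℂ → ℂ) (c r : ℝ) (u : ℂ) : Set ℂ :=
  {z : ℂ | g z = 0 ∧ |z.re - c| ≤ r ∧ z ≠ u ∧ z ≠ (starRingEnd ℂ) u}

/-- token check: §T `tentCount` is the multiplicity sum over `companions`. -/
theorem tentCount_eq_finsum_companions (g : ℂ → ℂ) (c r : ℝ) (u : ℂ) :
    tentCount g c r u = ∑ᶠ z ∈ companions g c r u, ((analyticOrderAt g z).toNat : ℝ) := rfl

/-- the companion set of the LINEAGE TENT at state `u` of level `j`, slope `ρ` (the set under §U `tentAt`). -/
def tentSet (ρ : ℝ) (f : ℂ → ℂ) (j : ℕ) (u : ℂ) : Set ℂ :=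
  companions (iteratedDeriv j f) u.re (ρ * u.im) u

/-- token check: §U `tentAt` is the multiplicity sum over `tentSet`. -/
theorem tentAt_eq_finsum_tentSet (ρ : ℝ) (f : ℂ → ℂ) (j : ℕ) (u : ℂ) :
    tentAt ρ f j u = ∑ᶠ z ∈ tentSet ρ f j u, ((analyticOrderAt (iteratedDeriv j f) z).toNat : ℝ) := rfl

/-- CLEAN (real) tent: every companion of `u` at level `j` is real. -/
def RealTent (ρ : ℝ) (f : ℂ → ℂ) (j : ℕ) (u : ℂ) : Prop :=
  ∀ z ∈ tentSet ρ f j u, z.im = 0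

/-- NO ENTRY (C6 ADD-21 (ii)): every companion of the new state `u'` (level `j+1`) lies in the real-part SHADOW of the old tent — between two companions of `u`. -/
def NoEntry (ρ : ℝ) (f : ℂ → ℂ) (j : ℕ) (u u' : ℂ) : Prop :=
  ∀ z' ∈ tentSet ρ f (j + 1) u', ∃ a ∈ tentSet ρ f j u, ∃ b ∈ tentSet ρ f j u, a.re ≤ z'.re ∧ z'.re ≤ b.re

/-- ★ **(R) RESTRICTED TENT HEREDITY** `TentHereditySig ρ` — research statement, NOT claimed: for engine data and consecutive lowest `StCol'` states
`u` (level `j`), `u'` (level `j+1`) with `u'` the surviving descendant of `u` (`‖u' − u‖ < Im u`), no lift, clean tents at both levels, no entry and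
`T_j(ρ) ≥ 1`:  `T_{j+1}(ρ)(u') ≤ T_j(ρ)(u) − 1`. -/
def TentHereditySig (ρ : ℝ) : Prop :=
  ∀ (η : ℝ) (f : ℂ → ℂ) (x₀ s hmax R Hs : ℝ) (B : ℕ), EngineHyps5 2 η f x₀ s hmax R Hs B →
    ∀ (j : ℕ) (u u' : ℂ), IsLowest StCol' η f x₀ s hmax R Hs B j u → IsLowest StCol' η f x₀ s hmax R Hs B (j + 1) u' →
      ‖u' - u‖ < u.im → u'.im ≤ u.im →
      RealTent ρ f j u → RealTent ρ f (j + 1) u' → NoEntry ρ f j u u' → 1 ≤ tentAt ρ f j u →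
        tentAt ρ f (j + 1) u' ≤ tentAt ρ f j u - 1

/-- (R) the same with C6's OBSERVABLE identity rule `|Re u' − Re u| ≤ s/2` added as a guard (the tables' antecedent; weaker statement). -/
def TentHereditySigObs (ρ : ℝ) : Prop :=
  ∀ (η : ℝ) (f : ℂ → ℂ) (x₀ s hmax R Hs : ℝ) (B : ℕ), EngineHyps5 2 η f x₀ s hmax R Hs B →
    ∀ (j : ℕ) (u u' : ℂ), IsLowest StCol' η f x₀ s hmax R Hs B j u → IsLowest StCol' η f x₀ s hmax R Hs B (j + 1) u' →
      ‖u' - u‖ < u.im → u'.im ≤ u.im → |u'.re - u.re| ≤ s / 2 →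
      RealTent ρ f j u → RealTent ρ f (j + 1) u' → NoEntry ρ f j u u' → 1 ≤ tentAt ρ f j u →
        tentAt ρ f (j + 1) u' ≤ tentAt ρ f j u - 1

/-- (K, trivial) the structural statement implies the observable one. -/
theorem tentHereditySigObs_of_sig {ρ : ℝ} (h : TentHereditySig ρ) : TentHereditySigObs ρ :=
  fun η f x₀ s hmax R Hs B hE j u u' hu hu' hd hl _ hR hR' hN hT => h η f x₀ s hmax R Hs B hE j u u' hu hu' hd hl hR hR' hN hT

/-- (R′) **OBSERVABLE / TABLES' VARIANT** `TentHereditySigSlow ρ θ` (C4 l.5202, C6 ADD-21 (iii)): no realness guard; guards = no lift, identity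
`|Re u' − Re u| ≤ s/2`, slow-level exclusion `θ·s ≤ Im u − Im u'`, no entry, `T_j ≥ 1`.  Research statement, NOT claimed; θ is a PARAMETER here —
a registered stub must use `TentHereditySigSlowEx` (`∃ θ < 1`) or the structural (R), never a hand-picked θ (checklist 4c(iv)). -/
def TentHereditySigSlow (ρ θ : ℝ) : Prop :=
  ∀ (η : ℝ) (f : ℂ → ℂ) (x₀ s hmax R Hs : ℝ) (B : ℕ), EngineHyps5 2 η f x₀ s hmax R Hs B →
    ∀ (j : ℕ) (u u' : ℂ), IsLowest StCol' η f x₀ s hmax R Hs B j u → IsLowest StCol' η f x₀ s hmax R Hs B (j + 1) u' →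
      u'.im ≤ u.im → |u'.re - u.re| ≤ s / 2 → θ * s ≤ u.im - u'.im → NoEntry ρ f j u u' → 1 ≤ tentAt ρ f j u →
        tentAt ρ f (j + 1) u' ≤ tentAt ρ f j u - 1

/-- (K) (R′) is monotone in the threshold: a larger `θ` excludes more levels, so the statement gets weaker. -/
theorem tentHereditySigSlow_mono {ρ θ θ' : ℝ} (hθ : θ ≤ θ') (h : TentHereditySigSlow ρ θ) : TentHereditySigSlow ρ θ' := by
  intro η f x₀ s hmax R Hs B hE j u u' hu hu' hl hid hslow hN hT
  have hs : 0 < s := hE.2.2.2.1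
  exact h η f x₀ s hmax R Hs B hE j u u' hu hu' hl hid ((mul_le_mul_of_nonneg_right hθ hs.le).trans hslow) hN hT

/-- (R′∃) the 4c(iv)-compliant research form: SOME threshold strictly below `1` works. -/
def TentHereditySigSlowEx (ρ : ℝ) : Prop := ∃ θ : ℝ, θ < 1 ∧ TentHereditySigSlow ρ θ

/-- (K) any witness threshold `θ₀ < 1` gives the research form. -/
theorem tentHereditySigSlowEx_of {ρ θ₀ : ℝ} (hθ₀ : θ₀ < 1) (h : TentHereditySigSlow ρ θ₀) : TentHereditySigSlowEx ρ := ⟨θ₀, hθ₀, h⟩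

/-- (K) under the descendant guard the new state is CLOSE in both coordinates: `|Re u' − Re u| < Im u` and `0 < Im u'` is automatic for `StCol'` states. -/
theorem re_sub_lt_of_descendant {u u' : ℂ} (hd : ‖u' - u‖ < u.im) : |u'.re - u.re| < u.im :=
  lt_of_le_of_lt (by simpa using abs_re_le_norm (u' - u)) hd

/-- (K) hence for `Im u ≤ s/2` the descendant guard already implies C6's identity rule, and the two statements AGREE on low states. -/
theorem identity_of_descendant_low {u u' : ℂ} {s : ℝ} (hd : ‖u' - u‖ < u.im) (hlow : u.im ≤ s / 2) : |u'.re - u.re| ≤ s / 2 :=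
  ((re_sub_lt_of_descendant hd).trans_le hlow).le

/-- (K) the EMPTY guard is not decoration: without `1 ≤ T_j` the conclusion `T_{j+1} ≤ T_j − 1` is refuted by any clean level with `T_j = 0`
(tent counts are ≥ 0; C6's EMPTY class, 12 levels). -/
theorem not_heredity_conclusion_of_empty {ρ : ℝ} {f : ℂ → ℂ} {j : ℕ} {u u' : ℂ} (h0 : tentAt ρ f j u = 0) :
    ¬ tentAt ρ f (j + 1) u' ≤ tentAt ρ f j u - 1 := by
  intro h
  have := tentAt_nonneg ρ f (j + 1) u'
  rw [h0] at h
  linarith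

/-- (K) SHAPE of the intended use (proof plan of the prefix node, words only): at a level satisfying the guards the tent pays the unit charge with NO lift,
i.e. the per-level clause (iii) of C1's `MonovariantStepG` holds there with `lam = 0` for the meter `T = tentAt ρ` read at these states:
`T(u') + 1 + 0/(μ s) ≤ T(u)`. -/
theorem step_clause_of_heredity {ρ μ s : ℝ} {f : ℂ → ℂ} {j : ℕ} {u u' : ℂ}
    (h : tentAt ρ f (j + 1) u' ≤ tentAt ρ f j u - 1) : tentAt ρ f (j + 1) u' + 1 + 0 / (μ * s) ≤ tentAt ρ f j u := by
  rw [zero_div, add_zero]; linarith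

end RhW07.C13.Heredity
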